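import Literature.AnabelianGeometry.SemiGraphs.PSCTwoComponentAffineFreeFactors
import Literature.GroupTheory.CombinatorialGroupTheory.PuncturedSurfaceGroupThreeChainClosures
import HarnessLib

/-!
# The THREE-COMPONENT CHAIN shape: free-factor geometry of a two-node degeneration ([CombGC] §1 data)

Mochizuki, *A combinatorial version of the Grothendieck conjecture* [CombGC] §1, Def. 1.1 and Prop. 1.2 /
1.5 pp. 6–13 [cite: MochizukiCombGC2007, Def 1.1 pp.6-7] [cite: MochizukiCombGC2007, Prop 1.5(i) p.12].
PROOF-ONLY file (abc-iut-f-164 gen 3).  THE DATA OF THREE-COMPONENT CHAIN SHAPE are what Def. 1.1 extracts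
from a pointed stable curve `C₀ ∪_{ν_A} C_mid ∪_{ν_B} C₁` (a CHAIN of three components, TWO nodes): `Π_G` a
pro-`Σ` completion `ι : Γ_{g,r} → Π`; handles `i < g₀` / `g₀ ≤ i < g₁` / `i ≥ g₁` and cusps `j ≥ s₂` /
`s₁ ≤ j < s₂` / `j < s₁` on `C₀` / `C_mid` / `C₁` (`2 ≤ s₁`, `s₁ + 2 ≤ s₂`, `s₂ + 2 ≤ r`);
`Π_{v₀} = cl ι⟨a_i,b_i (i<g₀), c_j (j≥s₂)⟩`, `Π_{v_mid} = cl ι⟨a_i,b_i (g₀≤i<g₁), c_j (s₁≤j<s₂), ε_A, η⟩`,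
`Π_{v₁} = cl ι⟨a_i,b_i (i≥g₁), c_j (j<s₁), η⟩`, `Π_{ν_A} = cl ι⟨ε_A⟩`, `Π_{ν_B} = cl ι⟨η⟩`, `Π_{c_j} = cl ι⟨c_j⟩`,
`ε_A = (c_{s₂}⋯c_{r−1})∏_{i<g₀}[a_i,b_i]`, `η = (c_{s₁}⋯c_{r−1})∏_{i<g₁}[a_i,b_i]` (the two separating loops).
HYPOTHESES on a `PSCDatum`; the identification with the PSC-fundamental group of the curve is not
constructed in the tree (FOUNDATIONS rows 13–14): consistency evidence for the typed rows only.

ONE free basis `B = (a_i, b_i, c_1..c_{s₁−1}, η, c_{s₁+1}..c_{s₂−1}, ε_A, c_{s₂+1}..c_{r−1})` of `Γ_{g,r}`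
(`PuncturedSurfaceGroupThreeChain{Bases,Closures}.lean`) carries ALL THREE vertex groups and BOTH node groups
as sub-basis closures (`S₀ ∩ S_mid = {ε_A}`, `S_mid ∩ S₁ = {η}`, `S₀ ∩ S₁ = ∅`); the cusps `c_0`, `c_{s₁}`,
`c_{s₂}` become members after one Nielsen move each (`exists_chainBases`).  abc-iut-L5-t6's free-factor
series (Ribes–Zalesskii 9.1.12 along a pro-`Σ` completion) then yields `threeChain_freeFactor_package`: all
the malnormality / commensurable-terminality / everywhere-trivial-intersection facts needed by the criteria
for [CombGC] Prop. 1.2 (i)(ii) and Prop. 1.5 (i) (`PSCThreeChainRows.lean`).  0 definitions; nothing here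
takes a side on [IUTchIII] Cor. 3.12.
-/

noncomputable section

namespace Literature.AnabelianGeometry.SemiGraphs

namespace PSCDatum

open scoped Pointwise
open Literature.GroupTheory.CombinatorialGroupTheory
open Literature.GroupTheory.CombinatorialGroupTheory.PuncturedSurfaceGroup (a b c cuspInertia
  exists_chainBases closure_chainFirst_eq closure_chainLast_eq closure_chainMid_eq)
open SemiGraphOfAnabelioids (IsProSigmaCompletion)
open SemiGraphOfAnabelioids.IsProSigmaCompletion (freeFactor_inf_conj_eq_bot_of_disjoint freeFactor_inf_eq
  infinite_freeFactor freeFactor_isCommensurablyTerminal mem_freeFactor_of_inf_conj_ne_bot)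

universe u

variable {P : Type u} [Group P] [TopologicalSpace P] [IsTopologicalGroup P]
variable [CompactSpace P] [T2Space P] [TotallyDisconnectedSpace P] {Sigma : Set ℕ} {g r : ℕ}

omit [TopologicalSpace P] [IsTopologicalGroup P] [CompactSpace P] [T2Space P]
  [TotallyDisconnectedSpace P] in
/-- An infinite subgroup is not trivial. [cite: MochizukiCombGC2007, Rmk 1.1.3 p.7] -/
private theorem ne_bot_of_infinite₃ {H : Subgroup P} (h : Infinite H) : H ≠ ⊥ := by
  rintro rfl
  exact h.not_finite inferInstance

omit [CompactSpace P] [T2Space P] [TotallyDisconnectedSpace P] in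
/-- `cl ι⟨x⟩ ≤ cl ι⟨S⟩` for `x ∈ ⟨S⟩`. [cite: MochizukiCombGC2007, Def 1.1(ii) p.6] -/
private theorem zpowers_closure_le₃ {Γ : Type*} [Group Γ] (ι : Γ →* P) {x : Γ} {S : Set Γ}
    (hx : x ∈ Subgroup.closure S) : ((Subgroup.zpowers x).map ι).topologicalClosure ≤
      ((Subgroup.closure S).map ι).topologicalClosure :=
  Subgroup.topologicalClosure_mono (Subgroup.map_mono ((Subgroup.zpowers_le (g := x)).mpr hx))

/-- **The free-factor package of the three-component chain shape.**  At every datum of three-component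
chain shape (module docstring): (1) the vertex groups and (2) the node groups are commensurably terminal;
(3) the vertex groups are malnormal; (4) the node groups are infinite; (5) node groups meet every conjugate
of every cusp group trivially, and (6) of each other; (7) for `v ≠ w` an infinite closed subgroup of `Π_v`
meets every conjugate of `Π_w` trivially; (8) `Π_{ν_A} ≤ Π_{v₀}, Π_{v_mid}` and meets every conjugate of
`Π_{v₁}` trivially, `Π_{ν_B} ≤ Π_{v_mid}, Π_{v₁}` and meets every conjugate of `Π_{v₀}` trivially; (9) each
cusp group lies in the group of its component and meets every conjugate of the other two trivially; (10)
the three vertex groups and the two node groups are pairwise distinct; (11) `Π_{v₀} ∩ Π_{v_mid} = Π_{ν_A}`,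
`Π_{v_mid} ∩ Π_{v₁} = Π_{ν_B}`.  All from ONE free basis of `Γ_{g,r}` (`exists_chainBases`) by
free-factor malnormality / disjointness. [cite: MochizukiCombGC2007, Prop 1.5(i) p.12]
[cite: MochizukiCombGC2007, Prop 1.2(ii) p.8] -/
theorem threeChain_freeFactor_package (hne : Sigma.Nonempty)
    (hprime : ∀ p ∈ Sigma, p.Prime) (ι : PuncturedSurfaceGroup g r →* P)
    (hι : IsProSigmaCompletion Sigma ι) (G : PSCDatum P) {g₀ g₁ s₁ s₂ : ℕ} (hg : g₀ ≤ g₁) (hs₁ : 2 ≤ s₁)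
    (hs₁₂ : s₁ + 2 ≤ s₂) (hs₂ : s₂ + 2 ≤ r) (e : G.graph.C ≃ Fin r)
    (hC : ∀ c, G.cuspGp c =
      ((PuncturedSurfaceGroup.cuspInertia (g := g) (e c)).map ι).topologicalClosure)
    (v₀ vm v₁ : G.graph.V) (hV : ∀ w, w = v₀ ∨ w = vm ∨ w = v₁) (εA η : PuncturedSurfaceGroup g r)
    (hεA : εA = ((List.finRange r).map fun j : Fin r =>
          if s₂ ≤ (j : ℕ) then PuncturedSurfaceGroup.c (g := g) j else 1).prod *
        ((List.finRange g).map fun i : Fin g => if (i : ℕ) < g₀ then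
          PuncturedSurfaceGroup.a (r := r) i * PuncturedSurfaceGroup.b i *
            (PuncturedSurfaceGroup.a i)⁻¹ * (PuncturedSurfaceGroup.b i)⁻¹ else 1).prod)
    (hη : η = ((List.finRange r).map fun j : Fin r =>
          if s₁ ≤ (j : ℕ) then PuncturedSurfaceGroup.c (g := g) j else 1).prod *
        ((List.finRange g).map fun i : Fin g => if (i : ℕ) < g₁ then
          PuncturedSurfaceGroup.a (r := r) i * PuncturedSurfaceGroup.b i *
            (PuncturedSurfaceGroup.a i)⁻¹ * (PuncturedSurfaceGroup.b i)⁻¹ else 1).prod)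
    (hV₀ : G.vertGp v₀ = ((Subgroup.closure {x : PuncturedSurfaceGroup g r |
        (∃ i : Fin g, (i : ℕ) < g₀ ∧ (x = PuncturedSurfaceGroup.a i ∨ x = PuncturedSurfaceGroup.b i)) ∨
        ∃ j : Fin r, s₂ ≤ (j : ℕ) ∧ x = PuncturedSurfaceGroup.c j}).map ι).topologicalClosure)
    (hVm : G.vertGp vm = ((Subgroup.closure {x : PuncturedSurfaceGroup g r |
        (∃ i : Fin g, (g₀ ≤ (i : ℕ) ∧ (i : ℕ) < g₁) ∧
          (x = PuncturedSurfaceGroup.a i ∨ x = PuncturedSurfaceGroup.b i)) ∨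
        (∃ j : Fin r, (s₁ ≤ (j : ℕ) ∧ (j : ℕ) < s₂) ∧ x = PuncturedSurfaceGroup.c j) ∨
        x = εA ∨ x = η}).map ι).topologicalClosure)
    (hV₁ : G.vertGp v₁ = ((Subgroup.closure {x : PuncturedSurfaceGroup g r |
        (∃ i : Fin g, g₁ ≤ (i : ℕ) ∧ (x = PuncturedSurfaceGroup.a i ∨ x = PuncturedSurfaceGroup.b i)) ∨
        (∃ j : Fin r, (j : ℕ) < s₁ ∧ x = PuncturedSurfaceGroup.c j) ∨ x = η}).map ι).topologicalClosure)
    (nA nB : G.graph.N) (hN : ∀ n, n = nA ∨ n = nB)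
    (hEA : G.nodeGp nA = ((Subgroup.zpowers εA).map ι).topologicalClosure)
    (hEB : G.nodeGp nB = ((Subgroup.zpowers η).map ι).topologicalClosure) :
    (∀ v, AbsoluteAnabelian.IsCommensurablyTerminal (G.vertGp v)) ∧
    (∀ n, AbsoluteAnabelian.IsCommensurablyTerminal (G.nodeGp n)) ∧
    (∀ (v : G.graph.V) (x : P), G.vertGp v ⊓ ConjAct.toConjAct x • G.vertGp v ≠ ⊥ → x ∈ G.vertGp v) ∧
    (∀ n, Infinite (G.nodeGp n)) ∧
    (∀ (n : G.graph.N) (c : G.graph.C) (x : P), G.nodeGp n ⊓ ConjAct.toConjAct x • G.cuspGp c = ⊥) ∧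
    (∀ x : P, G.nodeGp nA ⊓ ConjAct.toConjAct x • G.nodeGp nB = ⊥) ∧
    (∀ v w : G.graph.V, v ≠ w → ∃ Bv : Subgroup P, Bv ≤ G.vertGp v ∧ IsClosed (Bv : Set P) ∧
      Infinite Bv ∧ ∀ x : P, Bv ⊓ ConjAct.toConjAct x • G.vertGp w = ⊥) ∧
    (G.nodeGp nA ≤ G.vertGp v₀ ∧ G.nodeGp nA ≤ G.vertGp vm ∧
      (∀ x : P, G.nodeGp nA ⊓ ConjAct.toConjAct x • G.vertGp v₁ = ⊥) ∧
      G.nodeGp nB ≤ G.vertGp vm ∧ G.nodeGp nB ≤ G.vertGp v₁ ∧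
      (∀ x : P, G.nodeGp nB ⊓ ConjAct.toConjAct x • G.vertGp v₀ = ⊥)) ∧
    (∀ c : G.graph.C, ∃ u : G.graph.V, G.cuspGp c ≤ G.vertGp u ∧
      ∀ w, w ≠ u → ∀ x : P, G.cuspGp c ⊓ ConjAct.toConjAct x • G.vertGp w = ⊥) ∧
    (G.vertGp v₀ ≠ G.vertGp vm ∧ G.vertGp vm ≠ G.vertGp v₁ ∧ G.vertGp v₀ ≠ G.vertGp v₁ ∧
      G.nodeGp nA ≠ G.nodeGp nB) ∧
    (G.vertGp v₀ ⊓ G.vertGp vm = G.nodeGp nA ∧ G.vertGp vm ⊓ G.vertGp v₁ = G.nodeGp nB) := by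
  classical
  obtain ⟨r', rfl⟩ : ∃ r', r = r' + 1 := ⟨r - 1, by omega⟩
  have hp : ∃ p ∈ Sigma, p.Prime := hne.imp fun p hp => ⟨hp, hprime p hp⟩
  -- the chain basis and its three cusp variants
  obtain ⟨B, B₀, B₁, B₂, ha, hb, hc, hA, hBη, ⟨hB₀κ, hB₀⟩, ⟨hB₁τ, hB₁⟩, ⟨hB₂τ, hB₂⟩⟩ :=
    exists_chainBases hεA hη hg hs₁ (by omega) (by omega)
  -- index sets and special slots
  set S₀ : Set ((Fin g × Bool) ⊕ Fin r') :=
    {x | Sum.elim (fun p : Fin g × Bool => (p.1 : ℕ) < g₀) (fun j : Fin r' => s₂ ≤ (j : ℕ) + 1) x} with hS₀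
  set Sm : Set ((Fin g × Bool) ⊕ Fin r') :=
    {x | Sum.elim (fun p : Fin g × Bool => g₀ ≤ (p.1 : ℕ) ∧ (p.1 : ℕ) < g₁)
      (fun j : Fin r' => s₁ ≤ (j : ℕ) + 1 ∧ (j : ℕ) + 1 ≤ s₂) x} with hSm
  set S₁ : Set ((Fin g × Bool) ⊕ Fin r') :=
    {x | Sum.elim (fun p : Fin g × Bool => g₁ ≤ (p.1 : ℕ)) (fun j : Fin r' => (j : ℕ) + 1 ≤ s₁) x} with hS₁
  have h0l : ∀ p : Fin g × Bool, (Sum.inl p : (Fin g × Bool) ⊕ Fin r') ∈ S₀ ↔ (p.1 : ℕ) < g₀ :=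
    fun _ => Iff.rfl
  have h0r : ∀ j : Fin r', (Sum.inr j : (Fin g × Bool) ⊕ Fin r') ∈ S₀ ↔ s₂ ≤ (j : ℕ) + 1 := fun _ => Iff.rfl
  have hml : ∀ p : Fin g × Bool, (Sum.inl p : (Fin g × Bool) ⊕ Fin r') ∈ Sm ↔
      g₀ ≤ (p.1 : ℕ) ∧ (p.1 : ℕ) < g₁ := fun _ => Iff.rfl
  have hmr : ∀ j : Fin r', (Sum.inr j : (Fin g × Bool) ⊕ Fin r') ∈ Sm ↔
      s₁ ≤ (j : ℕ) + 1 ∧ (j : ℕ) + 1 ≤ s₂ := fun _ => Iff.rfl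
  have h1l : ∀ p : Fin g × Bool, (Sum.inl p : (Fin g × Bool) ⊕ Fin r') ∈ S₁ ↔ g₁ ≤ (p.1 : ℕ) :=
    fun _ => Iff.rfl
  have h1r : ∀ j : Fin r', (Sum.inr j : (Fin g × Bool) ⊕ Fin r') ∈ S₁ ↔ (j : ℕ) + 1 ≤ s₁ := fun _ => Iff.rfl
  set σA : (Fin g × Bool) ⊕ Fin r' := Sum.inr ⟨s₂ - 1, by omega⟩ with hσA
  set σB : (Fin g × Bool) ⊕ Fin r' := Sum.inr ⟨s₁ - 1, by omega⟩ with hσB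
  set κ₀ : (Fin g × Bool) ⊕ Fin r' := Sum.inr ⟨0, by omega⟩ with hκ₀
  set τ₁ : (Fin g × Bool) ⊕ Fin r' := Sum.inr ⟨s₁, by omega⟩ with hτ₁
  set τ₂ : (Fin g × Bool) ⊕ Fin r' := Sum.inr ⟨s₂, by omega⟩ with hτ₂
  have hσA0 : σA ∈ S₀ := (h0r _).mpr (by simp only; omega)
  have hσAm : σA ∈ Sm := (hmr _).mpr ⟨by simp only; omega, by simp only; omega⟩
  have hσA1 : σA ∉ S₁ := fun h => by have := (h1r _).mp h; simp only at this; omega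
  have hσBm : σB ∈ Sm := (hmr _).mpr ⟨by simp only; omega, by simp only; omega⟩
  have hσB1 : σB ∈ S₁ := (h1r _).mpr (by simp only; omega)
  have hσB0 : σB ∉ S₀ := fun h => by have := (h0r _).mp h; simp only at this; omega
  have hκ₀1 : κ₀ ∈ S₁ := (h1r _).mpr (by simp only; omega)
  have hκ₀0 : κ₀ ∉ S₀ := fun h => by have := (h0r _).mp h; simp only at this; omega
  have hκ₀m : κ₀ ∉ Sm := fun h => by have := (hmr _).mp h; simp only at this; omega
  have hτ₁m : τ₁ ∈ Sm := (hmr _).mpr ⟨by simp only; omega, by simp only; omega⟩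
  have hτ₁0 : τ₁ ∉ S₀ := fun h => by have := (h0r _).mp h; simp only at this; omega
  have hτ₁1 : τ₁ ∉ S₁ := fun h => by have := (h1r _).mp h; simp only at this; omega
  have hτ₂0 : τ₂ ∈ S₀ := (h0r _).mpr (by simp only; omega)
  have hτ₂m : τ₂ ∉ Sm := fun h => by have := (hmr _).mp h; simp only at this; omega
  have hτ₂1 : τ₂ ∉ S₁ := fun h => by have := (h1r _).mp h; simp only at this; omega
  have hAB : σA ≠ σB := by simp only [hσA, hσB, Ne, Sum.inr.injEq, Fin.mk.injEq]; omega
  have hS0m : S₀ ∩ Sm = {σA} := by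
    ext x; constructor
    · rintro ⟨h0, h1⟩
      rcases x with ⟨i, bb⟩ | j
      · exact absurd (lt_of_lt_of_le ((h0l _).mp h0) ((hml _).mp h1).1) (lt_irrefl _)
      · have h0' := (h0r _).mp h0; have h1' := (hmr _).mp h1
        rw [Set.mem_singleton_iff, hσA]
        exact congrArg Sum.inr (Fin.ext (by simp only; omega))
    · rintro rfl; exact ⟨hσA0, hσAm⟩
  have hSm1 : Sm ∩ S₁ = {σB} := by
    ext x; constructor
    · rintro ⟨h0, h1⟩
      rcases x with ⟨i, bb⟩ | j
      · exact absurd (lt_of_lt_of_le ((hml _).mp h0).2 ((h1l _).mp h1)) (lt_irrefl _)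
      · have h0' := (hmr _).mp h0; have h1' := (h1r _).mp h1
        rw [Set.mem_singleton_iff, hσB]
        exact congrArg Sum.inr (Fin.ext (by simp only; omega))
    · rintro rfl; exact ⟨hσBm, hσB1⟩
  have hS01 : Disjoint S₀ S₁ := by
    rw [Set.disjoint_left]
    intro x h0 h1
    rcases x with ⟨i, bb⟩ | j
    · exact absurd (lt_of_lt_of_le ((h0l _).mp h0) (le_trans hg ((h1l _).mp h1))) (lt_irrefl _)
    · have h0' := (h0r _).mp h0; have h1' := (h1r _).mp h1; omega
  -- representatives as sub-basis closures of `B`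
  have hA₀ : G.vertGp v₀ = ((Subgroup.closure (B '' S₀)).map ι).topologicalClosure := by
    rw [hV₀, closure_chainFirst_eq hεA ha hb hc hA (by omega) (by omega)]
  have hAm : G.vertGp vm = ((Subgroup.closure (B '' Sm)).map ι).topologicalClosure := by
    rw [hVm, closure_chainMid_eq hεA hη ha hb hc hA hBη hg (by omega) (by omega) (by omega)]
  have hA₁ : G.vertGp v₁ = ((Subgroup.closure (B '' S₁)).map ι).topologicalClosure := by
    rw [hV₁, closure_chainLast_eq hη ha hb hc hBη (by omega) (by omega) (by omega)]
  have hNA : G.nodeGp nA = ((Subgroup.closure (B '' {σA})).map ι).topologicalClosure := by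
    rw [hEA, closure_image_singleton, hσA, hA (by omega)]
  have hNB : G.nodeGp nB = ((Subgroup.closure (B '' {σB})).map ι).topologicalClosure := by
    rw [hEB, closure_image_singleton, hσB, hBη (by omega)]
  -- cusp groups as singleton sub-basis closures
  have hK : ∀ j : Fin (r' + 1), ((PuncturedSurfaceGroup.cuspInertia (g := g) j).map ι).topologicalClosure =
      ((Subgroup.zpowers (c (g := g) j)).map ι).topologicalClosure := fun _ => rfl
  have hKB : ∀ (j : Fin (r' + 1)) (hj0 : (j : ℕ) ≠ 0), (j : ℕ) ≠ s₁ → (j : ℕ) ≠ s₂ →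
      Subgroup.zpowers (c (g := g) j) =
        Subgroup.closure (B '' {Sum.inr (j.pred (fun h => hj0 (by rw [h]; rfl)))}) := by
    intro j hj0 hj1 hj2
    rw [closure_image_singleton, hc _ (by rw [Fin.val_pred]; omega) (by rw [Fin.val_pred]; omega),
      Fin.succ_pred]
  have hK₀ : Subgroup.zpowers (c (g := g) ⟨0, by omega⟩) = Subgroup.closure (B₀ '' {κ₀}) := by
    rw [closure_image_singleton, hκ₀, hB₀κ]
  have hK₁ : Subgroup.zpowers (c (g := g) ⟨s₁, by omega⟩) = Subgroup.closure (B₁ '' {τ₁}) := by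
    rw [closure_image_singleton, hτ₁, hB₁τ]
  have hK₂ : Subgroup.zpowers (c (g := g) ⟨s₂, by omega⟩) = Subgroup.closure (B₂ '' {τ₂}) := by
    rw [closure_image_singleton, hτ₂, hB₂τ]
  -- sub-basis closures unchanged under the three cusp moves
  have hcg : ∀ (B' : FreeGroupBasis ((Fin g × Bool) ⊕ Fin r') (PuncturedSurfaceGroup g (r' + 1)))
      (k : (Fin g × Bool) ⊕ Fin r') (S : Set ((Fin g × Bool) ⊕ Fin r')),
      (∀ x, x ≠ k → B' x = B x) → k ∉ S → Subgroup.closure (B '' S) = Subgroup.closure (B' '' S) :=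
    fun B' k S hB' hk => closure_image_congr fun x hx => (hB' x (fun h => hk (h ▸ hx))).symm
  -- generic disjointness in the basis `B` and its variants
  have hdj : ∀ (B' : FreeGroupBasis ((Fin g × Bool) ⊕ Fin r') (PuncturedSurfaceGroup g (r' + 1)))
      (S T : Set ((Fin g × Bool) ⊕ Fin r')), Disjoint S T → ∀ x : P,
      ((Subgroup.closure (B' '' S)).map ι).topologicalClosure ⊓
        ConjAct.toConjAct x • ((Subgroup.closure (B' '' T)).map ι).topologicalClosure = ⊥ :=
    fun B' S T hST x => freeFactor_inf_conj_eq_bot_of_disjoint B' S T hST hι x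
  -- (11) intersections, (10) distinctness
  have hinfA : G.vertGp v₀ ⊓ G.vertGp vm = G.nodeGp nA := by
    rw [hA₀, hAm, hNA, freeFactor_inf_eq B S₀ Sm hι, hS0m]
  have hinfB : G.vertGp vm ⊓ G.vertGp v₁ = G.nodeGp nB := by
    rw [hAm, hA₁, hNB, freeFactor_inf_eq B Sm S₁ hι, hSm1]
  have hne_of : ∀ (S T : Set ((Fin g × Bool) ⊕ Fin r')) (t : (Fin g × Bool) ⊕ Fin r'), t ∈ S → t ∉ T →
      ((Subgroup.closure (B '' S)).map ι).topologicalClosure ≠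
        ((Subgroup.closure (B '' T)).map ι).topologicalClosure := by
    intro S T t htS htT h
    have h0 := hdj B {t} T (Set.disjoint_singleton_left.mpr htT) 1
    rw [map_one, one_smul] at h0
    have hle : ((Subgroup.closure (B '' {t})).map ι).topologicalClosure ≤
        ((Subgroup.closure (B '' T)).map ι).topologicalClosure := by
      rw [← h]
      exact Subgroup.topologicalClosure_mono (Subgroup.map_mono (Subgroup.closure_mono
        (Set.image_mono (Set.singleton_subset_iff.mpr htS))))
    exact ne_bot_of_infinite₃ (infinite_freeFactor B {t} ⟨t, rfl⟩ hι hp)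
      (le_bot_iff.mp (h0 ▸ le_inf le_rfl hle))
  have hv0m : G.vertGp v₀ ≠ G.vertGp vm := by rw [hA₀, hAm]; exact hne_of S₀ Sm τ₂ hτ₂0 hτ₂m
  have hvm1 : G.vertGp vm ≠ G.vertGp v₁ := by rw [hAm, hA₁]; exact hne_of Sm S₁ τ₁ hτ₁m hτ₁1
  have hv01 : G.vertGp v₀ ≠ G.vertGp v₁ := by rw [hA₀, hA₁]; exact hne_of S₀ S₁ τ₂ hτ₂0 hτ₂1
  have hnAB : G.nodeGp nA ≠ G.nodeGp nB := by
    rw [hNA, hNB]; exact hne_of {σA} {σB} σA rfl (fun h => hAB (Set.mem_singleton_iff.mp h))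
  -- (5) node vs cusp
  have hNC : ∀ (σ : (Fin g × Bool) ⊕ Fin r'), (σ = σA ∨ σ = σB) → ∀ (j : Fin (r' + 1)) (x : P),
      ((Subgroup.closure (B '' {σ})).map ι).topologicalClosure ⊓ ConjAct.toConjAct x •
        ((PuncturedSurfaceGroup.cuspInertia (g := g) j).map ι).topologicalClosure = ⊥ := by
    intro σ hσ j x
    have hσκ : σ ≠ κ₀ := by
      rcases hσ with rfl | rfl <;> simp only [hσA, hσB, hκ₀, Ne, Sum.inr.injEq, Fin.mk.injEq] <;> omega
    have hστ₁ : σ ≠ τ₁ := by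
      rcases hσ with rfl | rfl <;> simp only [hσA, hσB, hτ₁, Ne, Sum.inr.injEq, Fin.mk.injEq] <;> omega
    have hστ₂ : σ ≠ τ₂ := by
      rcases hσ with rfl | rfl <;> simp only [hσA, hσB, hτ₂, Ne, Sum.inr.injEq, Fin.mk.injEq] <;> omega
    rw [hK]
    by_cases hj0 : (j : ℕ) = 0
    · have hj : j = ⟨0, by omega⟩ := Fin.ext hj0
      rw [hj, hK₀, hcg B₀ κ₀ {σ} hB₀ (fun h => hσκ (Set.mem_singleton_iff.mp h).symm)]
      exact hdj B₀ {σ} {κ₀} (Set.disjoint_singleton.mpr hσκ) x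
    · by_cases hj1 : (j : ℕ) = s₁
      · have hj : j = ⟨s₁, by omega⟩ := Fin.ext hj1
        rw [hj, hK₁, hcg B₁ τ₁ {σ} hB₁ (fun h => hστ₁ (Set.mem_singleton_iff.mp h).symm)]
        exact hdj B₁ {σ} {τ₁} (Set.disjoint_singleton.mpr hστ₁) x
      · by_cases hj2 : (j : ℕ) = s₂
        · have hj : j = ⟨s₂, by omega⟩ := Fin.ext hj2
          rw [hj, hK₂, hcg B₂ τ₂ {σ} hB₂ (fun h => hστ₂ (Set.mem_singleton_iff.mp h).symm)]
          exact hdj B₂ {σ} {τ₂} (Set.disjoint_singleton.mpr hστ₂) x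
        · rw [hKB j hj0 hj1 hj2]
          refine hdj B {σ} _ (Set.disjoint_singleton.mpr ?_) x
          rcases hσ with rfl | rfl <;>
            simp only [hσA, hσB, Ne, Sum.inr.injEq, Fin.ext_iff, Fin.val_pred] <;> omega
  -- (9) cusps vs the other vertex groups
  have hCV : ∀ (j : Fin (r' + 1)) (T : Set ((Fin g × Bool) ⊕ Fin r')),
      ((j : ℕ) ≠ 0 → (j : ℕ) ≠ s₁ → (j : ℕ) ≠ s₂ → ∀ k : Fin r', (k : ℕ) + 1 = (j : ℕ) → Sum.inr k ∉ T) →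
      ((j : ℕ) = 0 → κ₀ ∉ T) → ((j : ℕ) = s₁ → τ₁ ∉ T) → ((j : ℕ) = s₂ → τ₂ ∉ T) → ∀ x : P,
      ((PuncturedSurfaceGroup.cuspInertia (g := g) j).map ι).topologicalClosure ⊓
        ConjAct.toConjAct x • ((Subgroup.closure (B '' T)).map ι).topologicalClosure = ⊥ := by
    intro j T hjT h0T h1T h2T x
    rw [hK]
    by_cases hj0 : (j : ℕ) = 0
    · have hj : j = ⟨0, by omega⟩ := Fin.ext hj0
      rw [hj, hK₀, hcg B₀ κ₀ T hB₀ (h0T hj0)]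
      exact hdj B₀ {κ₀} T (Set.disjoint_singleton_left.mpr (h0T hj0)) x
    · by_cases hj1 : (j : ℕ) = s₁
      · have hj : j = ⟨s₁, by omega⟩ := Fin.ext hj1
        rw [hj, hK₁, hcg B₁ τ₁ T hB₁ (h1T hj1)]
        exact hdj B₁ {τ₁} T (Set.disjoint_singleton_left.mpr (h1T hj1)) x
      · by_cases hj2 : (j : ℕ) = s₂
        · have hj : j = ⟨s₂, by omega⟩ := Fin.ext hj2
          rw [hj, hK₂, hcg B₂ τ₂ T hB₂ (h2T hj2)]
          exact hdj B₂ {τ₂} T (Set.disjoint_singleton_left.mpr (h2T hj2)) x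
        · rw [hKB j hj0 hj1 hj2]
          exact hdj B _ T (Set.disjoint_singleton_left.mpr
            (hjT hj0 hj1 hj2 _ (by rw [Fin.val_pred]; omega))) x
  refine ⟨fun v => ?_, fun n => ?_, fun v x h => ?_, fun n => ?_, fun n c' x => ?_, fun x => ?_,
    fun v w hvw => ?_, ⟨?_, ?_, fun x => ?_, ?_, ?_, fun x => ?_⟩, fun c' => ?_,
    ⟨hv0m, hvm1, hv01, hnAB⟩, hinfA, hinfB⟩
  · -- (1) vertex groups commensurably terminal
    rcases hV v with rfl | rfl | rfl
    · rw [hA₀]; exact freeFactor_isCommensurablyTerminal B _ ⟨σA, hσA0⟩ hι hp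
    · rw [hAm]; exact freeFactor_isCommensurablyTerminal B _ ⟨σA, hσAm⟩ hι hp
    · rw [hA₁]; exact freeFactor_isCommensurablyTerminal B _ ⟨σB, hσB1⟩ hι hp
  · -- (2) node groups commensurably terminal
    rcases hN n with rfl | rfl
    · rw [hNA]; exact freeFactor_isCommensurablyTerminal B _ ⟨σA, rfl⟩ hι hp
    · rw [hNB]; exact freeFactor_isCommensurablyTerminal B _ ⟨σB, rfl⟩ hι hp
  · -- (3) malnormality
    rcases hV v with rfl | rfl | rfl
    · rw [hA₀] at h ⊢; exact mem_freeFactor_of_inf_conj_ne_bot B _ hι h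
    · rw [hAm] at h ⊢; exact mem_freeFactor_of_inf_conj_ne_bot B _ hι h
    · rw [hA₁] at h ⊢; exact mem_freeFactor_of_inf_conj_ne_bot B _ hι h
  · -- (4) node groups infinite
    rcases hN n with rfl | rfl
    · rw [hNA]; exact infinite_freeFactor B _ ⟨σA, rfl⟩ hι hp
    · rw [hNB]; exact infinite_freeFactor B _ ⟨σB, rfl⟩ hι hp
  · -- (5) node vs cusp
    rw [hC]
    rcases hN n with rfl | rfl
    · rw [hNA]; exact hNC σA (Or.inl rfl) (e c') x
    · rw [hNB]; exact hNC σB (Or.inr rfl) (e c') x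
  · -- (6) node vs node
    rw [hNA, hNB]; exact hdj B {σA} {σB} (Set.disjoint_singleton.mpr hAB) x
  · -- (7) vertex separation witnesses
    have key : ∀ (S T : Set ((Fin g × Bool) ⊕ Fin r')) (t : (Fin g × Bool) ⊕ Fin r'), t ∈ S → t ∉ T →
        ∃ Bv : Subgroup P, Bv ≤ ((Subgroup.closure (B '' S)).map ι).topologicalClosure ∧
          IsClosed (Bv : Set P) ∧ Infinite Bv ∧ ∀ x : P, Bv ⊓ ConjAct.toConjAct x •
            ((Subgroup.closure (B '' T)).map ι).topologicalClosure = ⊥ :=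
      fun S T t htS htT => ⟨((Subgroup.closure (B '' {t})).map ι).topologicalClosure,
        Subgroup.topologicalClosure_mono (Subgroup.map_mono (Subgroup.closure_mono
          (Set.image_mono (Set.singleton_subset_iff.mpr htS)))),
        Subgroup.isClosed_topologicalClosure _, infinite_freeFactor B {t} ⟨t, rfl⟩ hι hp,
        hdj B {t} T (Set.disjoint_singleton_left.mpr htT)⟩
    rcases hV v with rfl | rfl | rfl <;> rcases hV w with rfl | rfl | rfl
    · exact absurd rfl hvw
    · rw [hA₀, hAm]; exact key S₀ Sm τ₂ hτ₂0 hτ₂m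
    · rw [hA₀, hA₁]; exact key S₀ S₁ τ₂ hτ₂0 hτ₂1
    · rw [hAm, hA₀]; exact key Sm S₀ τ₁ hτ₁m hτ₁0
    · exact absurd rfl hvw
    · rw [hAm, hA₁]; exact key Sm S₁ τ₁ hτ₁m hτ₁1
    · rw [hA₁, hA₀]; exact key S₁ S₀ κ₀ hκ₀1 hκ₀0
    · rw [hA₁, hAm]; exact key S₁ Sm κ₀ hκ₀1 hκ₀m
    · exact absurd rfl hvw
  · rw [← hinfA]; exact inf_le_left
  · rw [← hinfA]; exact inf_le_right
  · rw [hNA, hA₁]; exact hdj B {σA} S₁ (Set.disjoint_singleton_left.mpr hσA1) x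
  · rw [← hinfB]; exact inf_le_left
  · rw [← hinfB]; exact inf_le_right
  · rw [hNB, hA₀]; exact hdj B {σB} S₀ (Set.disjoint_singleton_left.mpr hσB0) x
  · -- (9) each cusp: its vertex, and separation from the other two
    rw [hC]
    set j : Fin (r' + 1) := e c' with hj
    by_cases hj2 : s₂ ≤ (j : ℕ)
    · refine ⟨v₀, ?_, fun w hw x => ?_⟩
      · rw [hK, hV₀]; exact zpowers_closure_le₃ ι (Subgroup.subset_closure (Or.inr ⟨j, hj2, rfl⟩))
      · rcases hV w with rfl | rfl | rfl
        · exact absurd rfl hw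
        · rw [hAm]
          exact hCV j Sm (fun _ _ h2 k hk h => by have := (hmr _).mp h; omega)
            (fun h => absurd h (by omega)) (fun h => absurd h (by omega)) (fun _ => hτ₂m) x
        · rw [hA₁]
          exact hCV j S₁ (fun _ _ _ k hk h => by have := (h1r _).mp h; omega)
            (fun h => absurd h (by omega)) (fun h => absurd h (by omega)) (fun _ => hτ₂1) x
    · by_cases hj1 : s₁ ≤ (j : ℕ)
      · refine ⟨vm, ?_, fun w hw x => ?_⟩
        · rw [hK, hVm]
          exact zpowers_closure_le₃ ι (Subgroup.subset_closure (Or.inr (Or.inl ⟨j, ⟨hj1, by omega⟩, rfl⟩)))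
        · rcases hV w with rfl | rfl | rfl
          · rw [hA₀]
            exact hCV j S₀ (fun _ _ _ k hk h => by have := (h0r _).mp h; omega)
              (fun h => absurd h (by omega)) (fun _ => hτ₁0) (fun h => absurd h (by omega)) x
          · exact absurd rfl hw
          · rw [hA₁]
            exact hCV j S₁ (fun _ h1 _ k hk h => by have := (h1r _).mp h; omega)
              (fun h => absurd h (by omega)) (fun _ => hτ₁1) (fun h => absurd h (by omega)) x
      · refine ⟨v₁, ?_, fun w hw x => ?_⟩
        · rw [hK, hV₁]
          exact zpowers_closure_le₃ ι (Subgroup.subset_closure (Or.inr (Or.inl ⟨j, by omega, rfl⟩)))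
        · rcases hV w with rfl | rfl | rfl
          · rw [hA₀]
            exact hCV j S₀ (fun _ _ _ k hk h => by have := (h0r _).mp h; omega)
              (fun _ => hκ₀0) (fun h => absurd h (by omega)) (fun h => absurd h (by omega)) x
          · rw [hAm]
            exact hCV j Sm (fun _ _ _ k hk h => by have := (hmr _).mp h; omega)
              (fun _ => hκ₀m) (fun h => absurd h (by omega)) (fun h => absurd h (by omega)) x
          · exact absurd rfl hw

end PSCDatum

end Literature.AnabelianGeometry.SemiGraphs

end
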